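import Literature.RingTheory.LocalCohomology.CechVanishing
import HarnessLib

/-!
# Čech local cohomology vanishing passes to increasing unions of submodules

Topic `Literature/RingTheory/LocalCohomology`, sequel of `CechVanishing.lean`. Local cohomology
commutes with filtered colimits (SGA 2 Exp. II; The Stacks Project, Tag 0955 for cohomology and
colimits). We record the elementary Čech shadow that is needed for the Cohen–Macaulayness of
Kawasaki's blow-ups (Česnavičius 2021, proof of Thm. 3.13, (bam-bam): the module
`H²_{(r_i,r_s)}(M')` is an increasing union of pieces controlled by the inductive hypothesis): if the
`R`-module `M` is the increasing union of submodules `D 0 ⊆ D 1 ⊆ ⋯` and `Hⁱ_{(y)}(D i) = 0` for all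
`i` and all `i < n`... precisely `CechVanishBelow y (D i) n` for every `i`, then
`CechVanishBelow y M n` (`CechVanishBelow.of_iUnion`). The point is that a Čech cochain has finitely
many components, each a fraction with numerator in some `D i`, so it comes from a single `D i`,
while `Č(y; D i) → Č(y; M)` is injective.

Everything is proved; no named facts.

## References

* [Grothendieck1968SGA2] A. Grothendieck, SGA 2, Exp. II.
* [StacksProject] The Stacks Project, Tag 0955.
* [Cesnavicius2021] K. Česnavičius, *Macaulayfication of Noetherian schemes*, Duke Math. J. 170
  (2021), proof of Thm. 3.13, Claim 3.13.2.
-/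

noncomputable section

universe u

namespace Literature.RingTheory.LocalCohomology

open Pointwise

variable {R : Type u} [CommRing R] {s : ℕ} {y : Fin s → R} {M : Type u} [AddCommGroup M]
  [Module R M]

namespace CechVanishBelow

/-- The localisation of a smaller submodule lands in the localisation of a bigger one.
[folklore] -/
theorem range_locMap_subtype_mono {D D' : Submodule R M} (h : D ≤ D') {n : ℕ} (t : Fin n → Fin s) :
    LinearMap.range (locMap y D.subtype t) ≤ LinearMap.range (locMap y D'.subtype t) := by
  rintro _ ⟨w, rfl⟩
  induction w using LocalizedModule.induction_on with
  | h m k =>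
    refine ⟨LocalizedModule.mk ⟨(m : M), h m.2⟩ k, ?_⟩
    rw [locMap_mk, locMap_mk]
    rfl

/-- Every element of `M_{y_t}` comes from `(D i)_{y_t}` for some `i`, if `M = ⋃ D i`. [folklore] -/
theorem exists_mem_range_locMap_subtype (D : ℕ → Submodule R M) (hD : ∀ m : M, ∃ i, m ∈ D i)
    {n : ℕ} (t : Fin n → Fin s) (x : CechLoc y M t) :
    ∃ i, x ∈ LinearMap.range (locMap y (D i).subtype t) := by
  induction x using LocalizedModule.induction_on with
  | h m k =>
    obtain ⟨i, hi⟩ := hD m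
    exact ⟨i, LocalizedModule.mk ⟨m, hi⟩ k, by rw [locMap_mk]; rfl⟩

/-- Every Čech cochain of `M = ⋃ D i` (increasing) comes from a single `D i`. [folklore] -/
theorem exists_eq_cechObjMap_subtype (D : ℕ → Submodule R M) (hmono : Monotone D)
    (hD : ∀ m : M, ∃ i, m ∈ D i) (n : ℕ) (c : CechObj y M n) :
    ∃ (i : ℕ) (c' : CechObj y (D i) n), cechObjMap y (D i).subtype n c' = c := by
  classical
  choose ι hι using fun t : Fin (n + 1) → Fin s => exists_mem_range_locMap_subtype D hD t (c t)
  set i := Finset.univ.sup ι with hi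
  have hle : ∀ t, ι t ≤ i := fun t => Finset.le_sup (Finset.mem_univ t)
  have hmem : ∀ t, c t ∈ LinearMap.range (locMap y (D i).subtype t) := fun t =>
    range_locMap_subtype_mono (hmono (hle t)) t (hι t)
  choose f hf using hmem
  exact ⟨i, f, funext fun t => by rw [cechObjMap_apply, hf]⟩

/-- **Vanishing of local cohomology passes to increasing unions**: if `M = ⋃_i D i` for an
increasing sequence of submodules and `Hʲ_{(y)}(D i) = 0` for all `j < n` and all `i`, then
`Hʲ_{(y)}(M) = 0` for all `j < n`. [cite: Grothendieck1968SGA2, Exp. II]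
[cite: StacksProject, Tag 0955] -/
theorem of_iUnion (D : ℕ → Submodule R M) (hmono : Monotone D) (hD : ∀ m : M, ∃ i, m ∈ D i)
    {n : ℕ} (h : ∀ i, CechVanishBelow y (D i) n) : CechVanishBelow y M n := by
  have hinj : ∀ i (q : ℕ), Function.Injective (cechObjMap y (D i).subtype q) := fun i q =>
    cechObjMap_injective y _ (D i).injective_subtype q
  refine ⟨fun hn m hm => ?_, fun hn c hc => ?_, fun q hq c hc => ?_⟩
  · obtain ⟨i, hi⟩ := hD m
    have h0 : cechAug y (D i) ⟨m, hi⟩ = 0 := hinj i 0 (by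
      rw [← cechAug_map, map_zero]
      exact hm)
    have := (h i).1 hn ⟨m, hi⟩ h0
    exact congrArg Subtype.val this
  · obtain ⟨i, c', rfl⟩ := exists_eq_cechObjMap_subtype D hmono hD 0 c
    have hc' : dC 0 c' = 0 := hinj i 1 (by rw [← dC_cechObjMap, hc, map_zero])
    obtain ⟨m, hm⟩ := (h i).2.1 hn c' hc'
    exact ⟨m, by rw [← hm, ← cechAug_map]; rfl⟩
  · obtain ⟨i, c', rfl⟩ := exists_eq_cechObjMap_subtype D hmono hD (q + 1) c
    have hc' : dC (q + 1) c' = 0 := hinj i (q + 2) (by rw [← dC_cechObjMap, hc, map_zero])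
    obtain ⟨b, hb⟩ := (h i).2.2 q hq c' hc'
    exact ⟨cechObjMap y (D i).subtype q b, by rw [dC_cechObjMap, hb]⟩

/-- **Increasing unions, abstract form**: the same with the pieces given as modules `N i` mapping
compatibly and injectively into `M` (e.g. the terms of a direct system with injective transition
maps and `M` its colimit). [cite: Grothendieck1968SGA2, Exp. II] -/
theorem of_iUnion_range {N : ℕ → Type u} [∀ i, AddCommGroup (N i)] [∀ i, Module R (N i)]
    (f : ∀ i, N i →ₗ[R] M) (hf : ∀ i, Function.Injective (f i))
    (hmono : Monotone fun i => LinearMap.range (f i)) (hD : ∀ m : M, ∃ i, m ∈ LinearMap.range (f i))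
    {n : ℕ} (h : ∀ i, CechVanishBelow y (N i) n) : CechVanishBelow y M n :=
  of_iUnion (fun i => LinearMap.range (f i)) hmono hD fun i =>
    (h i).of_equiv (LinearEquiv.ofInjective (f i) (hf i))

end CechVanishBelow

end Literature.RingTheory.LocalCohomology

end
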